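import Summits.BirchSwinnertonDyer.BirchSwinnertonDyer.Theorems.CyclotomicUntwistCanonicalEigensymbolExistence
import Literature.NumberTheory.EllipticCurves.PAdicLFunctionInterpolationHoldsProofs
import HarnessLib

/-!
# Untwist eigensymbols, VI: the interpolation clauses of D1 are satisfiable for EVERY `α` — only the
# order-`½` growth sees the `U₃`-eigenvalue (a kernel certificate about the design of D1)

Cell `pub/bsd-wall` (D-0145 line `route-BirchSwinnertonDyer-CyclotomicUntwist`), seat `bsd-line-cycu-p3`
(prover seat 3/3); refuter-grade companion to files I–V, toward crux K1 `PSRankOneLowerHalfAtThree`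
(stmt-BirchSwinnertonDyer-21580) / want F1 (`wi-84943`).  THEOREMS ONLY (no definition, no named fact, no
`sorry`).  BSD is not proved by this file and no crux of the route is proved by it.

WHAT.  D1 (`IsUntwistedPAdicLFunction p f η α μ`) is the conjunction of (1) additivity, (2) growth of order
`½`, (3) the interpolation clause at EVERY finite-order character of `Γ`.  This file proves:

* §1 `gammaCharValue_pushforward_of_eigensymbol` — clause (3) for the twisted push-forward of ANY untwist
  eigensymbol `Φ` on `ℤ[1/p]` ((S1)–(S3) of file III), for every `α ≠ 0, p`; NO bound on `Φ`, NO condition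
  on `‖α‖` (the interpolation block of file III's main theorem, isolated).
* §2 `exists_isGammaDistribution_and_interpolation` — hence, with the canonical symbol of files IV/V: for
  `η` PRIMITIVE mod `p^c` (`c ≥ 1`) and EVERY `α ∈ ℂ_p ∖ {0, p}` there is an ADDITIVE `L` satisfying ALL
  interpolation clauses of D1 for `(f, η, α)`.  Clauses (1)+(3) of D1 carry no information about `α`.
* §3 `exists_hasGrowthOrder_one_and_interpolation` — if moreover `f` is a rational newform (Manin–Drinfeld
  in the tree: bounded denominators of `[r]⁺_f`) and `‖p‖ < ‖α‖` (every `α` of slope `< 1`, e.g. every `α`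
  of slope `½`), that `L` has growth of order `1` (`HasGrowthOrder p 1`): the canonical values grow
  at most like `‖α/p‖ⁿ` (`norm_canonical_le_pow`).  Order `1 = k − 1` is exactly Višik's critical slope, where
  uniqueness fails; D1's order `½` is therefore the ENTIRE content of «`α = a₃(g)`» — a sharp form of the
  route's kill criterion (i), and the reason the typed K1/K2 closers quantifying `∃ α 𝓛` are not vacuous
  only through clause (2).

References: [cite: MazurTateTeitelbaum1986Invent, §I.11 and §I.14] · [cite: Bellaiche2021, Def. 6.2.10, Thm. 6.2.13 and Thm. 6.7.9]
· [cite: Manin1972, Cor. 3.6].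
-/

noncomputable section

open Finset
open Literature.NumberTheory.EllipticCurves Literature.NumberTheory.EllipticCurves.ModularForms
  Literature.NumberTheory.IwasawaTheory

-- single-conjunct summit: `Summit.BirchSwinnertonDyer.BirchSwinnertonDyer.…` repeats the name by design
set_option linter.dupNamespace false

namespace Summit.BirchSwinnertonDyer.BirchSwinnertonDyer.Theorems.PSUntwistExistence

variable {p : ℕ} [Fact p.Prime] {N : ℕ} {f : CuspForm (CongruenceSubgroup.Gamma0 N) 2} {c : ℕ}
  {η : DirichletCharacter ℂ_[p] (p ^ c)} {α : ℂ_[p]} {Φ : ℚ → ℂ_[p]}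
  {ν L : (n : ℕ) → ZMod (p ^ n) → ℂ_[p]}

/-! ### §1 The interpolation clause needs neither the bound (S4) nor a condition on `‖α‖` -/

/-- **Clause (3) of D1 for the push-forward of any untwist eigensymbol.**  For `α ≠ 0, p` and `Φ` with
(S1), (S2), (S3) on `ℤ[1/p]` (no bound, no norm condition on `α`), the twisted push-forward `L` of
`ν(a + p^Lℤ_p) = α^{-L}Φ(a/p^L)` takes the value prescribed by D1 at every character `ξ` of `Γ`:
`gammaCharValue p L ξ = untwistMultiplier p α n · untwistSymbolSum p f η χ` for the primitive `χ` of `η̄ξ`.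
(The interpolation block of file III's `isUntwistedPAdicLFunction_of_eigensymbol`, verbatim.)
[cite: MazurTateTeitelbaum1986Invent, §I.13–§I.14] [cite: Bellaiche2021, Thm. 6.7.9] -/
theorem gammaCharValue_pushforward_of_eigensymbol (f : CuspForm (CongruenceSubgroup.Gamma0 N) 2)
    (hα : α ≠ 0) (hαp : α ≠ p)
    (hper : ∀ (n : ℕ) (a z : ℤ), Φ ((a : ℚ) / (p : ℚ) ^ n + z) = Φ ((a : ℚ) / (p : ℚ) ^ n))
    (heig : ∀ (n : ℕ) (a : ℤ), ∑ j : Fin p, Φ (((a : ℚ) / (p : ℚ) ^ n + j) / p) = α * Φ ((a : ℚ) / (p : ℚ) ^ n))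
    (hdep : ∀ (n : ℕ) (a : ℤ), Φ ((a : ℚ) / (p : ℚ) ^ n) - α / p * Φ (p * ((a : ℚ) / (p : ℚ) ^ n)) =
      ∑ b : ZMod (p ^ c), η b *
        algebraMap ℚ ℂ_[p] (ratPlusSymbol f ((a : ℚ) / (p : ℚ) ^ n + (b.val : ℚ) / (p : ℚ) ^ c)))
    (hν : ∀ (L : ℕ) (a : ZMod (p ^ L)), ν L a = α⁻¹ ^ L * Φ ((a.val : ℚ) / (p : ℚ) ^ L))
    (hL : ∀ (n : ℕ) (s : ZMod (p ^ n)), L n s =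
      ∑ᶠ ζ : rootsOfUnity (torsionOrder p) ℤ_[p],
        ∑ b ∈ univ.filter (fun b : ZMod (p ^ (n + cyclotomicExponent p + c)) ↦
          ZMod.castHom (pow_dvd_pow p (Nat.le_add_right _ c)) (ZMod (p ^ (n + cyclotomicExponent p))) b =
            classOf p n ζ s),
          (η (ZMod.castHom (pow_dvd_pow p (Nat.le_add_left c _)) (ZMod (p ^ c)) b))⁻¹ *
            ν (n + cyclotomicExponent p + c) b)
    {m : ℕ} (ξ : DirichletCharacter ℂ_[p] (p ^ m)) (heven : ξ.Even) (hord : ∃ j : ℕ, orderOf ξ = p ^ j)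
    {n : ℕ} (χ : DirichletCharacter ℂ_[p] (p ^ n)) (hχ : χ.IsPrimitive)
    (hχη : ∀ a : ℕ, a.Coprime p → χ (a : ZMod (p ^ n)) = (η (a : ZMod (p ^ c)))⁻¹ * ξ (a : ZMod (p ^ m))) :
    gammaCharValue p L ξ = untwistMultiplier p α n * untwistSymbolSum p f η χ := by
  classical
  have hdist := sum_fiber_symbolMeasure_succ' heig hα hν
  rw [gammaCharValue_pushforward hL ξ heven hord]
  have h1K : 1 ≤ m + cyclotomicExponent p + c := by
    have := cyclotomicExponent_ne_zero p; omega
  have hmK : m ≤ m + cyclotomicExponent p + c := by omega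
  have hcK : c ≤ m + cyclotomicExponent p + c := Nat.le_add_left c _
  haveI : NeZero (p ^ (m + cyclotomicExponent p + c)) := ⟨pow_ne_zero _ (Fact.out : p.Prime).ne_zero⟩
  rw [show (∑ u : (ZMod (p ^ (m + cyclotomicExponent p + c)))ˣ,
      ξ (ZMod.castHom (pow_dvd_pow p hmK) (ZMod (p ^ m)) (u : ZMod (p ^ (m + cyclotomicExponent p + c)))) *
        ((η (ZMod.castHom (pow_dvd_pow p hcK) (ZMod (p ^ c))
            (u : ZMod (p ^ (m + cyclotomicExponent p + c)))))⁻¹ *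
          ν (m + cyclotomicExponent p + c) u)) =
      ∑ u : (ZMod (p ^ (m + cyclotomicExponent p + c)))ˣ, ν (m + cyclotomicExponent p + c) u *
        (ξ (ZMod.castHom (pow_dvd_pow p hmK) (ZMod (p ^ m)) (u : ZMod (p ^ (m + cyclotomicExponent p + c)))) *
          (η (ZMod.castHom (pow_dvd_pow p hcK) (ZMod (p ^ c))
            (u : ZMod (p ^ (m + cyclotomicExponent p + c)))))⁻¹) from
    Finset.sum_congr rfl fun u _ ↦ by ring]
  have hw : ∀ {K' : ℕ} (hK'm : m ≤ K') (hK'c : c ≤ K') (hn : n ≤ K') (hK'1 : 1 ≤ K')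
      (u : (ZMod (p ^ K'))ˣ),
      ξ (ZMod.castHom (pow_dvd_pow p hK'm) (ZMod (p ^ m)) (u : ZMod (p ^ K'))) *
          (η (ZMod.castHom (pow_dvd_pow p hK'c) (ZMod (p ^ c)) (u : ZMod (p ^ K'))))⁻¹ =
        χ (ZMod.castHom (pow_dvd_pow p hn) (ZMod (p ^ n)) (u : ZMod (p ^ K'))) := by
    intro K' hK'm hK'c hn hK'1 u
    rw [castHom_units_eq_natCast_val hK'm u, castHom_units_eq_natCast_val hK'c u,
      castHom_units_eq_natCast_val hn u, hχη _ (coprime_val_units hK'1 u), mul_comm]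
  rcases n with _ | k
  · have hsub : Subsingleton (ZMod (p ^ 0)) := by rw [pow_zero]; infer_instance
    have hχ1 : ∀ x : ZMod (p ^ 0), χ x = 1 := fun x ↦ by
      rw [Subsingleton.elim x 1, map_one]
    have hdown := sum_units_mul_of_distribution' hdist le_rfl h1K (fun _ : ZMod (p ^ 1) ↦ (1 : ℂ_[p]))
    simp only [mul_one] at hdown
    rw [Finset.sum_congr rfl fun u _ ↦ by rw [hw hmK hcK (Nat.zero_le _) h1K u, hχ1, mul_one], hdown,
      sum_units_symbolMeasure_level_one hdist hν, untwistMultiplier_zero_mul_untwistSymbolSum f hαp hdep χ]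
  · have hup := sum_units_mul_of_distribution' hdist h1K (Nat.le_add_right _ (k + 1))
      (fun a : ZMod (p ^ (m + cyclotomicExponent p + c)) ↦
        ξ (ZMod.castHom (pow_dvd_pow p hmK) (ZMod (p ^ m)) a) *
          (η (ZMod.castHom (pow_dvd_pow p hcK) (ZMod (p ^ c)) a))⁻¹)
    rw [← hup, Finset.sum_congr rfl fun u _ ↦ by
      rw [castHom_castHom_zmod, castHom_castHom_zmod,
        hw (hmK.trans (Nat.le_add_right _ (k + 1))) (hcK.trans (Nat.le_add_right _ (k + 1)))
          (Nat.le_add_left (k + 1) _) (h1K.trans (Nat.le_add_right _ (k + 1))) u]]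
    have hdown := sum_units_mul_of_distribution' hdist (Nat.succ_pos k)
      (Nat.le_add_left (k + 1) (m + cyclotomicExponent p + c)) (fun a : ZMod (p ^ (k + 1)) ↦ χ a)
    rw [hdown]
    haveI : NeZero (p ^ (k + 1)) := ⟨pow_ne_zero _ (Fact.out : p.Prime).ne_zero⟩
    rw [sum_units_eq_sum_filter_isUnit (F := fun a : ZMod (p ^ (k + 1)) ↦ ν (k + 1) a * χ a),
      Finset.sum_filter, ← sum_mul_symbolMeasure_succ f hper hdep hν k χ hχ]
    refine Finset.sum_congr rfl fun a _ ↦ ?_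
    split_ifs with ha
    · exact mul_comm _ _
    · rw [MulChar.map_nonunit χ ha, zero_mul]

/-! ### §2 For every `α`: an additive system with all interpolation clauses of D1 -/

/-- **Clauses (1) and (3) of D1 are satisfiable for EVERY `α ≠ 0, p`.**  For `η` primitive mod `p^c`,
`c ≥ 1`: there is an ADDITIVE system of ball values on `Γ` (`IsGammaDistribution`) taking, at EVERY
finite-order character `ξ` of `Γ`, the value `e_n(α) · untwistSymbolSum p f η χ` that D1 prescribes — namely
the twisted push-forward of the canonical symbol `Ψ_{f,η,α}` (files IV/V: (S1)–(S3) hold for every `α`).  So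
of D1's three clauses only the growth of order `½` can distinguish the `U_p`-eigenvalue of the untwist from
any other `α`. [cite: MazurTateTeitelbaum1986Invent, §I.11 and §I.14] [cite: Bellaiche2021, Thm. 6.2.13 and Thm. 6.7.9] -/
theorem exists_isGammaDistribution_and_interpolation [NeZero N] (f : CuspForm (CongruenceSubgroup.Gamma0 N) 2)
    (hη : η.IsPrimitive) (hc : 1 ≤ c) (hα : α ≠ 0) (hαp : α ≠ p) :
    ∃ L : (n : ℕ) → ZMod (p ^ n) → ℂ_[p], IsGammaDistribution p L ∧
      ∀ (m : ℕ) (ξ : DirichletCharacter ℂ_[p] (p ^ m)), ξ.IsPrimitive → ξ.Even →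
        (∃ j : ℕ, orderOf ξ = p ^ j) →
        ∀ (n : ℕ) (χ : DirichletCharacter ℂ_[p] (p ^ n)), χ.IsPrimitive →
          (∀ a : ℕ, a.Coprime p →
            χ (a : ZMod (p ^ n)) = (η (a : ZMod (p ^ c)))⁻¹ * ξ (a : ZMod (p ^ m))) →
          gammaCharValue p L ξ = untwistMultiplier p α n * untwistSymbolSum p f η χ := by
  obtain ⟨Ψ, h1, h2, h3⟩ := exists_eigensymbol (α := α) f hη hc hαp
  refine ⟨fun n s ↦ ∑ᶠ ζ : rootsOfUnity (torsionOrder p) ℤ_[p],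
      ∑ b ∈ univ.filter (fun b : ZMod (p ^ (n + cyclotomicExponent p + c)) ↦
        ZMod.castHom (pow_dvd_pow p (Nat.le_add_right _ c)) (ZMod (p ^ (n + cyclotomicExponent p))) b =
          classOf p n ζ s),
        (η (ZMod.castHom (pow_dvd_pow p (Nat.le_add_left c _)) (ZMod (p ^ c)) b))⁻¹ *
          (α⁻¹ ^ (n + cyclotomicExponent p + c) *
            Ψ ((b.val : ℚ) / (p : ℚ) ^ (n + cyclotomicExponent p + c))), ?_, ?_⟩
  · exact isGammaDistribution_pushforward (ν := fun L a ↦ α⁻¹ ^ L * Ψ ((a.val : ℚ) / (p : ℚ) ^ L))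
      (sum_fiber_symbolMeasure_succ' (ν := fun L a ↦ α⁻¹ ^ L * Ψ ((a.val : ℚ) / (p : ℚ) ^ L)) h2 hα
        (fun _ _ ↦ rfl)) (fun _ _ ↦ rfl)
  · intro m ξ _ heven hord n χ hχ hχη
    exact gammaCharValue_pushforward_of_eigensymbol f hα hαp h1 h2 h3
      (ν := fun L a ↦ α⁻¹ ^ L * Ψ ((a.val : ℚ) / (p : ℚ) ^ L)) (fun _ _ ↦ rfl) (fun _ _ ↦ rfl)
      ξ heven hord χ hχ hχη

/-! ### §3 For every `α` of slope `< 1`: growth of the CRITICAL order `1` -/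

/-- **The `p`-deprived twisted symbol is bounded** for a rational newform: `‖∑_b η(b)[r + b/p^c]⁺_f‖ ≤ ‖1/D‖`
with `D` the common denominator of the rational plus symbols (Manin–Drinfeld, PROVED in the tree:
`exists_nsmul_modularSymbol_mem_periodLattice_of_isNewform0`, `exists_forall_ratPlusSymbol_eq_div_of_maninDrinfeld`),
since `‖η(b)‖ ≤ 1` and `ℂ_p` is ultrametric. [cite: Manin1972, Cor. 3.6] [cite: MazurTateTeitelbaum1986Invent, §I.11] -/
theorem exists_norm_twistSymbol_le [NeZero N] (hf : IsNewform0 f) (hQ : coeffField f = ⊥)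
    (η : DirichletCharacter ℂ_[p] (p ^ c)) :
    ∃ C : ℝ, 0 ≤ C ∧ ∀ r : ℚ,
      ‖∑ b : ZMod (p ^ c), η b * algebraMap ℚ ℂ_[p] (ratPlusSymbol f (r + (b.val : ℚ) / (p : ℚ) ^ c))‖ ≤ C := by
  obtain ⟨D, _, hden⟩ := exists_forall_ratPlusSymbol_eq_div_of_maninDrinfeld
    (exists_nsmul_modularSymbol_mem_periodLattice_of_isNewform0 hf hQ)
  refine ⟨‖(D : ℂ_[p])‖⁻¹, inv_nonneg.mpr (norm_nonneg _), fun r ↦ ?_⟩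
  refine IsUltrametricDist.norm_sum_le_of_forall_le_of_nonneg (inv_nonneg.mpr (norm_nonneg _)) fun b _ ↦ ?_
  obtain ⟨m, hm⟩ := hden (r + (b.val : ℚ) / (p : ℚ) ^ c)
  rw [hm, norm_mul, map_div₀, map_intCast, map_natCast, norm_div, div_eq_mul_inv]
  calc ‖η b‖ * (‖(m : ℂ_[p])‖ * ‖(D : ℂ_[p])‖⁻¹) ≤ 1 * (1 * ‖(D : ℂ_[p])‖⁻¹) := by
        refine mul_le_mul (η.norm_le_one b) (mul_le_mul_of_nonneg_right ?_ (inv_nonneg.mpr (norm_nonneg _)))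
          (by positivity) zero_le_one
        obtain ⟨k, rfl | rfl⟩ := m.eq_nat_or_neg
        · exact_mod_cast norm_natCast_padicComplex_le_one (p := p) k
        · rw [Int.cast_neg, norm_neg]; exact_mod_cast norm_natCast_padicComplex_le_one (p := p) k
    _ = ‖(D : ℂ_[p])‖⁻¹ := by ring

/-- **The canonical values grow at most like `‖α/p‖ⁿ`**: if `‖H‖ ≤ C` and `q = α/p` has `‖q‖ > 1` (every `α`
of slope `< 1`), then `‖∑_{k<n} qᵏ H(pᵏ r) + qⁿ(1 − q)⁻¹H(0)‖ ≤ C ‖q‖ⁿ` (ultrametric; `‖1 − q‖ = ‖q‖`).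
[cite: Bellaiche2021, Def. 6.2.10] -/
theorem norm_canonical_le_pow {H : ℚ → ℂ_[p]} {C : ℝ} (hC0 : 0 ≤ C) (hH : ∀ r : ℚ, ‖H r‖ ≤ C)
    (hq : 1 < ‖α / p‖) (r : ℚ) (n : ℕ) :
    ‖∑ k ∈ range n, (α / p) ^ k * H ((p : ℚ) ^ k * r) + (α / p) ^ n * (1 - α / p)⁻¹ * H 0‖ ≤
      C * ‖α / p‖ ^ n := by
  have hq1 : 1 ≤ ‖α / p‖ := hq.le
  have h1q : ‖1 - α / p‖ = ‖α / p‖ := by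
    rw [sub_eq_add_neg, IsUltrametricDist.norm_add_eq_max_of_norm_ne_norm
      (by rw [norm_one, norm_neg]; exact hq.ne), norm_one, norm_neg, max_eq_right hq.le]
  refine (IsUltrametricDist.norm_add_le_max _ _).trans (max_le ?_ ?_)
  · refine IsUltrametricDist.norm_sum_le_of_forall_le_of_nonneg (by positivity) fun k hk ↦ ?_
    rw [norm_mul, norm_pow, mul_comm]
    exact mul_le_mul (hH _) (pow_le_pow_right₀ hq1 (Finset.mem_range.mp hk).le) (by positivity) hC0
  · rw [norm_mul, norm_mul, norm_inv, norm_pow, h1q, mul_comm]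
    refine mul_le_mul (hH 0) ?_ (by positivity) hC0
    rcases n with _ | n
    · rw [pow_zero, one_mul]
      exact inv_le_one_of_one_le₀ hq1
    · rw [pow_succ, mul_assoc, mul_inv_cancel₀ (by positivity), mul_one]
      exact pow_le_pow_right₀ hq1 n.le_succ

/-- **Growth of order `1` of the twisted push-forward from a bound `‖ν(a + p^Lℤ_p)‖ ≤ C p^L`** (ultrametric
inequality, `‖η(b)⁻¹‖ ≤ 1`; the order-`1` twin of file III's `hasGrowthOrder_pushforward_of_norm_le`).
[cite: Bellaiche2021, Def. 6.2.10] -/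
theorem hasGrowthOrder_one_pushforward_of_norm_le {C : ℝ}
    (hνb : ∀ (L : ℕ) (a : ZMod (p ^ L)), ‖ν L a‖ ≤ C * (p : ℝ) ^ L)
    (hL : ∀ (n : ℕ) (s : ZMod (p ^ n)), L n s =
      ∑ᶠ ζ : rootsOfUnity (torsionOrder p) ℤ_[p],
        ∑ b ∈ univ.filter (fun b : ZMod (p ^ (n + cyclotomicExponent p + c)) ↦
          ZMod.castHom (pow_dvd_pow p (Nat.le_add_right _ c)) (ZMod (p ^ (n + cyclotomicExponent p))) b =
            classOf p n ζ s),
          (η (ZMod.castHom (pow_dvd_pow p (Nat.le_add_left c _)) (ZMod (p ^ c)) b))⁻¹ *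
            ν (n + cyclotomicExponent p + c) b) :
    HasGrowthOrder p 1 L := by
  classical
  haveI := neZero_torsionOrder p
  haveI := Fintype.ofFinite (rootsOfUnity (torsionOrder p) ℤ_[p])
  have hp0 : (0 : ℝ) < p := by exact_mod_cast (Fact.out : p.Prime).pos
  have hC0 : 0 ≤ C := by
    have h := hνb 0 0
    simp only [pow_zero, mul_one] at h
    exact (norm_nonneg _).trans h
  refine ⟨C * (p : ℝ) ^ (cyclotomicExponent p + c), fun n s ↦ ?_⟩
  have hK : C * (p : ℝ) ^ (cyclotomicExponent p + c) * (p : ℝ) ^ ((1 : ℝ) * n) =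
      C * (p : ℝ) ^ (n + cyclotomicExponent p + c) := by
    rw [one_mul, Real.rpow_natCast, mul_assoc, ← pow_add]
    ring_nf
  rw [hK, hL, finsum_eq_sum_of_fintype]
  refine IsUltrametricDist.norm_sum_le_of_forall_le_of_nonneg (by positivity) fun ζ _ ↦ ?_
  refine IsUltrametricDist.norm_sum_le_of_forall_le_of_nonneg (by positivity) fun b _ ↦ ?_
  rw [norm_mul]
  calc _ ≤ 1 * (C * (p : ℝ) ^ (n + cyclotomicExponent p + c)) :=
        mul_le_mul (norm_inv_apply_le_one η _) (hνb _ b) (norm_nonneg _) zero_le_one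
    _ = _ := one_mul _

/-- **For EVERY `α` with `‖p‖ < ‖α‖` (slope `< 1`; e.g. every `α` of slope `½`): an additive system with ALL
interpolation clauses of D1 and growth of the CRITICAL order `1`.**  (`f` a rational newform — the
tree's Manin–Drinfeld bounds the symbols; `η` primitive mod `p^c`, `c ≥ 1`.)  The canonical values are
`O(‖α/p‖ⁿ)` (`norm_canonical_le_pow`), so `ν = α⁻ⁿΨ` is `O(pⁿ)`.  Order `1` is Višik's critical order
(Bellaïche Thm. 6.2.13 needs `< k − 1 = 1`): there uniqueness fails, and indeed these systems exist for a
continuum of `α`.  D1's clause «order `½`» is what singles out `α = a_p(g)`.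
[cite: Bellaiche2021, Thm. 6.2.13 and Thm. 6.7.9] [cite: MazurTateTeitelbaum1986Invent, §I.11 and §I.14] [cite: Manin1972, Cor. 3.6] -/
theorem exists_hasGrowthOrder_one_and_interpolation [NeZero N] (hf : IsNewform0 f)
    (hQ : coeffField f = ⊥) (hη : η.IsPrimitive) (hc : 1 ≤ c) (hαp1 : ‖(p : ℂ_[p])‖ < ‖α‖) :
    ∃ L : (n : ℕ) → ZMod (p ^ n) → ℂ_[p], IsGammaDistribution p L ∧ HasGrowthOrder p 1 L ∧
      ∀ (m : ℕ) (ξ : DirichletCharacter ℂ_[p] (p ^ m)), ξ.IsPrimitive → ξ.Even →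
        (∃ j : ℕ, orderOf ξ = p ^ j) →
        ∀ (n : ℕ) (χ : DirichletCharacter ℂ_[p] (p ^ n)), χ.IsPrimitive →
          (∀ a : ℕ, a.Coprime p →
            χ (a : ZMod (p ^ n)) = (η (a : ZMod (p ^ c)))⁻¹ * ξ (a : ZMod (p ^ m))) →
          gammaCharValue p L ξ = untwistMultiplier p α n * untwistSymbolSum p f η χ := by
  have hp : p.Prime := Fact.out
  have hp0 : (p : ℂ_[p]) ≠ 0 := Nat.cast_ne_zero.mpr hp.ne_zero
  have hnp : ‖(p : ℂ_[p])‖ = (p : ℝ)⁻¹ := by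
    rw [← map_natCast (algebraMap ℚ_[p] ℂ_[p]) p, norm_algebraMap', Padic.norm_p]
  have hα : α ≠ 0 := fun h ↦ by rw [h, norm_zero] at hαp1; exact (not_lt.mpr (norm_nonneg _)) hαp1
  have hαp : α ≠ p := fun h ↦ by rw [h] at hαp1; exact lt_irrefl _ hαp1
  have hq : 1 < ‖α / p‖ := by
    rw [norm_div, one_lt_div ((norm_pos_iff).mpr hp0)]
    exact hαp1
  -- the canonical symbol and its bound
  obtain ⟨Ψ, hΨ⟩ := exists_canonical_symbol f η hαp
  obtain ⟨h1, h2, h3⟩ := canonical_symbol_isEigensymbol hη hc hαp hΨ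
  obtain ⟨C, hC0, hC⟩ := exists_norm_twistSymbol_le hf hQ η
  have hΨb : ∀ (n : ℕ) (a : ℤ), ‖Ψ ((a : ℚ) / (p : ℚ) ^ n)‖ ≤ C * ‖α / p‖ ^ n := by
    intro n a
    rw [hΨ]
    have h := norm_canonical_le_pow (α := α) (H := fun r ↦ ∑ b : ZMod (p ^ c), η b *
      algebraMap ℚ ℂ_[p] (ratPlusSymbol f (r + (b.val : ℚ) / (p : ℚ) ^ c))) hC0 hC hq
      ((a : ℚ) / (p : ℚ) ^ n) n
    simpa only [zero_add] using h
  -- the ball values `ν = α^{-L} Ψ` are `O(p^L)`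
  have hνb : ∀ (L : ℕ) (a : ZMod (p ^ L)),
      ‖α⁻¹ ^ L * Ψ ((a.val : ℚ) / (p : ℚ) ^ L)‖ ≤ C * (p : ℝ) ^ L := by
    intro L a
    have h := hΨb L (a.val : ℕ)
    simp only [Int.cast_natCast] at h
    rw [norm_mul, norm_pow, norm_inv]
    calc ‖α‖⁻¹ ^ L * ‖Ψ ((a.val : ℚ) / (p : ℚ) ^ L)‖ ≤ ‖α‖⁻¹ ^ L * (C * ‖α / p‖ ^ L) :=
          mul_le_mul_of_nonneg_left h (by positivity)
      _ = C * (‖α‖⁻¹ * ‖α / p‖) ^ L := by rw [mul_pow]; ring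
      _ = C * (p : ℝ) ^ L := by
          have hαn0 : ‖α‖ ≠ 0 := norm_ne_zero_iff.mpr hα
          have hp0r : (p : ℝ) ≠ 0 := by exact_mod_cast hp.ne_zero
          rw [norm_div, hnp, show ‖α‖⁻¹ * (‖α‖ / (p : ℝ)⁻¹) = (p : ℝ) by field_simp]
  refine ⟨fun n s ↦ ∑ᶠ ζ : rootsOfUnity (torsionOrder p) ℤ_[p],
      ∑ b ∈ univ.filter (fun b : ZMod (p ^ (n + cyclotomicExponent p + c)) ↦
        ZMod.castHom (pow_dvd_pow p (Nat.le_add_right _ c)) (ZMod (p ^ (n + cyclotomicExponent p))) b =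
          classOf p n ζ s),
        (η (ZMod.castHom (pow_dvd_pow p (Nat.le_add_left c _)) (ZMod (p ^ c)) b))⁻¹ *
          (α⁻¹ ^ (n + cyclotomicExponent p + c) *
            Ψ ((b.val : ℚ) / (p : ℚ) ^ (n + cyclotomicExponent p + c))), ?_, ?_, ?_⟩
  · exact isGammaDistribution_pushforward (ν := fun L a ↦ α⁻¹ ^ L * Ψ ((a.val : ℚ) / (p : ℚ) ^ L))
      (sum_fiber_symbolMeasure_succ' (ν := fun L a ↦ α⁻¹ ^ L * Ψ ((a.val : ℚ) / (p : ℚ) ^ L)) h2 hα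
        (fun _ _ ↦ rfl)) (fun _ _ ↦ rfl)
  · exact hasGrowthOrder_one_pushforward_of_norm_le
      (ν := fun L a ↦ α⁻¹ ^ L * Ψ ((a.val : ℚ) / (p : ℚ) ^ L)) hνb (fun _ _ ↦ rfl)
  · intro m ξ _ heven hord n χ hχ hχη
    exact gammaCharValue_pushforward_of_eigensymbol f hα hαp h1 h2 h3
      (ν := fun L a ↦ α⁻¹ ^ L * Ψ ((a.val : ℚ) / (p : ℚ) ^ L)) (fun _ _ ↦ rfl) (fun _ _ ↦ rfl)
      ξ heven hord χ hχ hχη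

end Summit.BirchSwinnertonDyer.BirchSwinnertonDyer.Theorems.PSUntwistExistence

end
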